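import Summits.BirchSwinnertonDyer.BirchSwinnertonDyer.Theorems.ResidualThetaTransportAtTwoSignedMuVanishingAtTwoPlusSel2
import Summits.BirchSwinnertonDyer.BirchSwinnertonDyer.Theorems.ResidualThetaTransportAtTwoSignedMuSeedAtTwoPlusSplitFiniteness
import Summits.BirchSwinnertonDyer.BirchSwinnertonDyer.Theorems.ResidualThetaTransportAtTwoHeckeThetaPartnerAdicAtTwo
import Summits.BirchSwinnertonDyer.BirchSwinnertonDyer.Theorems.ResidualThetaTransportAtTwoCuspSpanDefs
import Literature.NumberTheory.EllipticCurves.FineSelmerClassGroupCriterion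
import Literature.NumberTheory.EllipticCurves.MazurTateElementCoeffField

/-!
# Line `theta-symbol-seed` for crux `SignedMuSeedAtTwoPlus` (stmt-BirchSwinnertonDyer-21438) — crux-ideate r1 k2 (g4)

THE SEED IS THE THETA PARTNER, NOT A CURVE.  The crux allows `A := W`; what a seed must supply is
«`Sel⁺(W/ℚ_∞)[2]` finite» (door p580570).  Every μ-road analysed so far funnels into two K-side statements over
the resolvent field `K_W = ℚ(√Δ_W)` (imaginary, `2` inert): (F) classical `μ₂ = 0` of `ℚ(W[2])^{cyc}` and
(T) the `χ_W`-unit line is transverse to Kobayashi's plus line at the inert prime — and BOTH are the statement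
«the plus-Coleman image of the `χ_W`-elliptic-unit family has `μ = 0`», i.e. the ANALYTIC `μ⁺ = 0` of the
CM theta partner `g = θ_ψ` that K0⁺ (`HeckeThetaPartnerAdicAtTwo`, PROVED: `heckeThetaPartnerAdicAtTwo_proof`)
hands us at an odd level `M` with a COHOMOLOGICAL plus period.  This line certifies that analytic input on the
GL₂ side, by the SAME curve-free cusp-span combinatorics (G′)_M = `CuspSpanEvenAtTwo M` that the sibling analytic
crux 21437 already rests on (landed kernel chain p592546 → p593268 for rational newforms; stub 2 is its port to
`𝒪_ι`-coefficients, where the cohomological clause replaces the Manin-constant step), and then runs the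
rank-one `GL₁` machine over `K_W` (elliptic units ⊗ χ_W: Johnson-Leung–Kings Thm 5.2 at `p = 2`, Wiles /
de Shalit explicit reciprocity in the Lubin–Tate tower of `(ℚ₄, −2)`, and the period parity
`Ω_g^{coh} ∼ Ω_∞(K_W)·(2-adic unit)` at the inert prime) to get (F) (stub 3) and (T) (stub 4).  Stubs 5–6 are
the tree's Lim-2017-at-two bookkeeping shared verbatim with line `resolvent-elliptic-units` (one proof serves
both).  So, conditionally on (G′) — ONE combinatorial conjecture, a finite check per odd level — BOTH halves of
Kμ⁺ 20689 close through the partner.  BSD is not proved by any of this: stubs 1, 3, 4 are research statements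
(1 conjecture-grade but finitely checkable per level; 3–4 printed for odd / split primes only).
-/

open WeierstrassCurve Literature.NumberTheory.EllipticCurves
open Literature.NumberTheory.EllipticCurves.ModularForms
open Literature.NumberTheory.EllipticCurves.Kobayashi2003
open Literature.NumberTheory.EllipticCurves.Rank1Residual
open Literature.NumberTheory.IwasawaTheory
open Summit.BirchSwinnertonDyer.BirchSwinnertonDyer.Theses.ResidualThetaTransportAtTwo

set_option autoImplicit false
set_option linter.dupNamespace false

noncomputable section

namespace Summit.BirchSwinnertonDyer.BirchSwinnertonDyer.Cruxes.SignedMuSeedAtTwoPlus.ThetaSymbolSeed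

/-! ## Carriers (tree objects only) -/

/-- **FLAT for the partner**: some EVEN-layer Mazur–Tate element `θ_n(g)` (Pollack–Weston (2.1), period `Ω`,
read in `ℚ̄₂` along `ι`) has a UNIT coefficient.  For a cohomological `Ω` every coefficient has norm `≤ 1`, and by
the three-term relation with `a₂(g) = 0` a unit coefficient at one even layer persists at all larger even layers;
it says `μ(L⁻_𝒪(g)) = 0` for every `𝒪`-Pollack pair (Pollack's labelling; even layers = Kobayashi's sign `+`,
the sign of the crux). -/
def PartnerFlatAtTwo {M : ℕ} (g : CuspForm (CongruenceSubgroup.Gamma0 M) 2)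
    (ι : coeffField g →+* PadicAlgCl 2) (Ω : ℂ) : Prop :=
  ∃ n : ℕ, Even n ∧ ∃ j : ℕ, ‖ι ((mazurTateElementK g Ω 2 n).coeff j)‖ = 1

/-- **`(M, g, ι, Ω)` is a K0⁺ theta partner of `W`** — VERBATIM the conjunction produced by the route's proved
crux `HeckeThetaPartnerAdicAtTwo`: odd level, newform on `Γ₀(M)`, CM, `a₂(g) = 0`, `Ω` a cohomological plus period
along `ι`, and `ι a_ℓ(g) ≡ a_ℓ(W)` for every prime `ℓ ∤ 2 M N_W`. -/
def IsThetaPartnerAtTwo (W : WeierstrassCurve ℚ) [W.IsElliptic] [W.IsGloballyMinimal] (M : ℕ) [NeZero M]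
    (g : CuspForm (CongruenceSubgroup.Gamma0 M) 2) (ι : coeffField g →+* PadicAlgCl 2) (Ω : ℂ) : Prop :=
  Odd M ∧ IsNewform0 g ∧ Literature.NumberTheory.Automorphic.IsCMForm (liftToGamma1 M 2 g) ∧ cuspCoeff g 2 = 0 ∧
    IsCohomologicalPlusPeriod g ι Ω ∧
    ∀ ℓ : ℕ, ℓ.Prime → ¬ ℓ ∣ 2 * M * W.conductorNorm ℤ → ‖embCoeff g ι ℓ - (W.frobeniusTrace ℓ : PadicAlgCl 2)‖ < 1

/-! ## Registered stub statements (named `Prop`s) -/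

/-- **Stub 1 (conjecture-grade, FINITELY CHECKABLE per level; shared with the analytic crux 21437's consumers
`flatMuZeroAtTwo_of_forall_cuspSpanEvenAtTwo` / `signedMuAnalyticAtTwoPlus_of_abbesUllmo_of_forall_cuspSpanEvenAtTwo`):
the curve-free cusp-span statement (G′)_N on `Γ₀(N)` for every odd `N`** (verified exactly by kit j295333/j296726 for
every odd `N ≤ 2999` with genus `≥ 1` and for the habitat⁺ conductors; OPEN in general).  Only the partner levels
`M ∣ |d_{K_W}|·t²` are consumed. -/
def CuspSpanOdd : Prop :=
  ∀ (N : ℕ) [NeZero N], ¬ 2 ∣ N → Theorems.SignedMuAtTwo.CuspSpanEvenAtTwo N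

/-- **Stub 2 (size M–L, PORT of the landed rational kernel chain p592546 → p593268 to `𝒪_ι`-coefficients):
(G′)_M ⟹ FLAT for every newform `g` on `Γ₀(M)`, `M` odd, with `a₂(g) = 0`, at a cohomological plus period.**
Same proof with `ℤ → 𝒪_ι`, «odd» → «unit»: compose the `𝒪_ι`-valued period functional with `𝒪_ι → k_ι` and any
`𝔽₂`-linear functional `k_ι → 𝔽₂`; it is nonzero by the cohomological clause (this replaces the Manin-constant /
Abbes–Ullmo step of the rational case) and non-Eisenstein at `T₂` because `ι a₂(g) + 2 + 1 = 3` is a unit; (G′)_M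
then produces `γ` with `d(γ) = 4^k` and a unit symbol, i.e. a unit coefficient at an even layer.  `a₂(g) = 0`
forces `ρ̄_{g,ι}|_{G_{ℚ₂}}` irreducible, so no Eisenstein escape. -/
def PartnerFlatOfCuspSpan : Prop :=
  ∀ (M : ℕ) [NeZero M] (g : CuspForm (CongruenceSubgroup.Gamma0 M) 2) (ι : coeffField g →+* PadicAlgCl 2) (Ω : ℂ),
    Odd M → Theorems.SignedMuAtTwo.CuspSpanEvenAtTwo M → IsNewform0 g → cuspCoeff g 2 = 0 →
    IsCohomologicalPlusPeriod g ι Ω → PartnerFlatAtTwo g ι Ω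

/-- **Stub 3 (size XL, research — the CLASS-GROUP half (F) from the partner's flatness):** on the habitat⁺, for
a theta partner `(M, g, ι, Ω)` of `W`, FLAT(g) ⟹ classical `μ₂ = 0` for the cyclotomic `ℤ₂`-extension of the
`2`-division field `ℚ(W[2]) = K_W(χ_W)`.  Mechanism (all `GL₁` over `K_W`, `2` inert): (E4) period parity
`θ_n(g)^ι ≐ (unit)·(χ_W-branch of the elliptic-unit measure at layer n)` (Ω_g^{coh} vs Ω_∞(K_W): canonical =
cohomological for the non-Eisenstein `𝔪`, and the CM period ratio is a `2`-adic unit at an inert prime of good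
reduction); (E2) Wiles / de Shalit explicit reciprocity in the LT_{(ℚ₄,−2)} tower: the measure is `Col(ζ_χ)`;
so FLAT(g) ⟹ `μ(Col⁺ ζ_χ) = 0` ⟹ `μ((ℰ/𝒞)^χ) = 0` (rank-one: `Col⁺ ζ = f·Col⁺ j₀` with `f` a characteristic
element of `(ℰ/𝒞)^χ`); (E1) the elliptic-unit Euler-system divisibility at `p = 2` (Johnson-Leung–Kings 2011
Thm 5.2) `char Cl_∞^χ ∣ char (ℰ/𝒞)^χ`, plus Ferrero–Washington for the `χ = 1` part.  Printed only for `p`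
odd (Pollack–Rubin 2004 §7, Lei 2011 §7 assume `p > 2`, rational `g`, `h_K = 1`). -/
def FineHalfOfPartnerFlat : Prop :=
  ∀ (W : WeierstrassCurve ℚ) [W.IsElliptic] [W.IsGloballyMinimal], ¬ W.HasCM → W.analyticRank = 0 →
    GoodSS W 2 → W.frobeniusTrace 2 = 0 → W.Δ < 0 →
    ∀ (M : ℕ) [NeZero M] (g : CuspForm (CongruenceSubgroup.Gamma0 M) 2) (ι : coeffField g →+* PadicAlgCl 2)
      (Ω : ℂ), IsThetaPartnerAtTwo W M g ι Ω → PartnerFlatAtTwo g ι Ω →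
      ∀ κM : ZpExtension (W.divisionField 2) 2, κM.IsCyclotomic → ClassicalMuVanishes κM

/-- **Stub 4 (size XL, research — the UNIT-SIGNATURE half (T) from the partner's flatness):** on the habitat⁺,
for a theta partner of `W`, FLAT(g) ⟹ for every cyclotomic `κ` the image of `Sel⁺(W/ℚ_∞)[2]` in `H¹/Sel₀` is
finite.  Mechanism: that image is controlled by the `χ_W`-units of `ℚ(W[2])·ℚ_n` whose Kummer classes at the
inert prime lie in Kobayashi's plus line of `Ŵ ⊗ ℤ₄ ≅` LT_{(ℚ₄,−2)}; the `χ_W`-unit line is `Λ`-generated by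
`j₀` with `ζ_χ = f·j₀`, and `μ(Col⁺ ζ_χ) = 0` (from FLAT(g) via (E4)+(E2) as in stub 3) gives `μ(Col⁺ j₀) = 0`,
i.e. the unit line is NOT asymptotically plus-adic, which bounds the plus-position units layer by layer.  Shares
the explicit-reciprocity input with the CM route's ER⁺@2 and with `resolvent-elliptic-units` stub 5; differs from
the latter by taking the ANALYTIC input from FLAT(g) instead of a Sinnott–Gillard independence theorem. -/
def PlusHalfOfPartnerFlat : Prop :=
  ∀ (W : WeierstrassCurve ℚ) [W.IsElliptic] [W.IsGloballyMinimal], ¬ W.HasCM → W.analyticRank = 0 →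
    GoodSS W 2 → W.frobeniusTrace 2 = 0 → W.Δ < 0 →
    ∀ (M : ℕ) [NeZero M] (g : CuspForm (CongruenceSubgroup.Gamma0 M) 2) (ι : coeffField g →+* PadicAlgCl 2)
      (Ω : ℂ), IsThetaPartnerAtTwo W M g ι Ω → PartnerFlatAtTwo g ι Ω →
      ∀ κ : ZpExtension ℚ 2, κ.IsCyclotomic →
        ((QuotientAddGroup.mk' (W.fineSelmerInfty κ)) ''
          {x : W.subgroupH1 2 κ.kerSubgroup | x ∈ signedSelmerInfty W κ 1 ∧ 2 • x = 0}).Finite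

/-- **Stub 5 (size L, literature `_holds`; VERBATIM `resolvent-elliptic-units` stub 1 / `fine-plus-split` stub 1):
Lim 2017 Thm 3.5 with Lemma 3.2 at `p = 2`** (tree named fact). -/
def LimAtTwo : Prop :=
  Lim2017.thm35_at_two_fineSelmerDual_moduleFinite_of_classicalMuVanishes_of_le_divisionField_four

/-- **Stub 6 (size M; VERBATIM `resolvent-elliptic-units` stub 2): `ℚ(W[2]) ≤ ℚ(W[4])` with `2`-power index.** -/
def DivisionTowerTwoFour : Prop :=
  ∀ (W : WeierstrassCurve ℚ) [W.IsElliptic],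
    W.divisionField 2 ≤ W.divisionField 4 ∧
      ∃ k : ℕ, Module.finrank ℚ (W.divisionField 4) = 2 ^ k * Module.finrank ℚ (W.divisionField 2)

theorem stub_cuspSpanOdd : CuspSpanOdd := by
  sorry

theorem stub_partnerFlatOfCuspSpan : PartnerFlatOfCuspSpan := by
  sorry

theorem stub_fineHalfOfPartnerFlat : FineHalfOfPartnerFlat := by
  sorry

theorem stub_plusHalfOfPartnerFlat : PlusHalfOfPartnerFlat := by
  sorry

theorem stub_limAtTwo : LimAtTwo := by
  sorry

theorem stub_divisionTowerTwoFour : DivisionTowerTwoFour := by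
  sorry

/-! ## Assembly (sorry-free glue) and the registrar theorem -/

/-- GLUE 1 (no sorry): every habitat⁺ curve has a FLAT theta partner — K0⁺ (PROVED in the tree,
`heckeThetaPartnerAdicAtTwo_proof`) ∧ stub 1 at the partner level ∧ stub 2. -/
theorem exists_flat_thetaPartner (h1 : CuspSpanOdd) (h2 : PartnerFlatOfCuspSpan) :
    ∀ (W : WeierstrassCurve ℚ) [W.IsElliptic] [W.IsGloballyMinimal], ¬ W.HasCM → W.analyticRank = 0 →
      GoodSS W 2 → W.frobeniusTrace 2 = 0 → W.Δ < 0 →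
      ∃ (M : ℕ) (_ : NeZero M) (g : CuspForm (CongruenceSubgroup.Gamma0 M) 2) (ι : coeffField g →+* PadicAlgCl 2)
        (Ω : ℂ), IsThetaPartnerAtTwo W M g ι Ω ∧ PartnerFlatAtTwo g ι Ω := by
  intro W _ _ hCM hr hss ha hΔ
  obtain ⟨M, hM, g, ι, Ω, hP⟩ := Theorems.heckeThetaPartnerAdicAtTwo_proof W hCM hr hss ha hΔ
  haveI := hM
  have h2M : ¬ 2 ∣ M := fun h ↦ (Nat.not_even_iff_odd.mpr hP.1) (even_iff_two_dvd.mpr h)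
  exact ⟨M, hM, g, ι, Ω, (id hP : IsThetaPartnerAtTwo W M g ι Ω),
    h2 M g ι Ω hP.1 (h1 M h2M) hP.2.1 hP.2.2.2.1 hP.2.2.2.2.1⟩

/-- GLUE 2 (no sorry): the Sel2-door hypothesis with `A := W` — «`Sel⁺(W/ℚ_∞)[2]` finite at every cyclotomic
`(κ, γ)`» — from the six stub STATEMENTS, through the flat partner, Lim 2017 at two with `L := ℚ(W[2])` and the
landed `FineSplit.splitFiniteness` (p596845). -/
theorem sel2Seed_of_stubs (h1 : CuspSpanOdd) (h2 : PartnerFlatOfCuspSpan) (h3 : FineHalfOfPartnerFlat)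
    (h4 : PlusHalfOfPartnerFlat) (h5 : LimAtTwo) (h6 : DivisionTowerTwoFour) :
    ∀ (W : WeierstrassCurve ℚ) [W.IsElliptic] [W.IsGloballyMinimal], ¬ W.HasCM → W.analyticRank = 0 →
      GoodSS W 2 → W.frobeniusTrace 2 = 0 → W.Δ < 0 →
      ∀ (κ : ZpExtension ℚ 2) (γ : Field.absoluteGaloisGroup ℚ), κ.IsCyclotomic → κ.IsTopGenerator γ →
        {s : signedSelmerInfty W κ 1 | 2 • s = 0}.Finite := by
  intro W _ _ hCM hr hss ha hΔ κ γ hκ hγ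
  obtain ⟨M, hM, g, ι, Ω, hP, hflat⟩ := exists_flat_thetaPartner h1 h2 W hCM hr hss ha hΔ
  haveI := hM
  obtain ⟨hle, hk⟩ := h6 W
  exact Theorems.SignedMuAtTwo.FineSplit.splitFiniteness W κ γ hκ hγ
    (fun κ' hκ' ↦ h5 W (W.divisionField 2) hle hk (h3 W hCM hr hss ha hΔ M g ι Ω hP hflat) κ' hκ')
    (h4 W hCM hr hss ha hΔ M g ι Ω hP hflat κ hκ)

/-- **THE SKELETON THEOREM (registrar shape): the crux BY NAME; the unique theorem of this file concluding it;
the only `sorry`s in its closure are the six `stub_*` theorems** (Sel2 door p580570 with `A := W`,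
`e := AddEquiv.refl`; the partner enters only through the stubs' hypotheses — the seed curve is `W` itself). -/
theorem SignedMuSeedAtTwoPlus_of :
    Summit.BirchSwinnertonDyer.BirchSwinnertonDyer.Theses.ResidualThetaTransportAtTwo.SignedMuSeedAtTwoPlus := by
  refine Theorems.SignedMuAtTwo.signedMuSeedAtTwoPlus_of_sel2Seed ?_
  intro W _ _ hCM hr hss ha hΔ
  exact ⟨W, ‹_›, ‹_›, hss, ha, ⟨AddEquiv.refl _, fun σ P ↦ rfl⟩, fun κ γ hκ hγ _ ↦
    sel2Seed_of_stubs stub_cuspSpanOdd stub_partnerFlatOfCuspSpan stub_fineHalfOfPartnerFlat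
      stub_plusHalfOfPartnerFlat stub_limAtTwo stub_divisionTowerTwoFour W hCM hr hss ha hΔ κ γ hκ hγ⟩

end Summit.BirchSwinnertonDyer.BirchSwinnertonDyer.Cruxes.SignedMuSeedAtTwoPlus.ThetaSymbolSeed

end
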